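import Summits.KontsevichZagierPeriods.KontsevichZagierPeriods.Theorems.HurwitzMicroSectorsHurwitzSectorComplementStubBottomCellAux
import Literature.NumberTheory.Transcendental.KZRelationsLE
import Literature.NumberTheory.Transcendental.KZRulesAssociator
import Literature.NumberTheory.Transcendental.KZDominatedFamilyRelations
import Summits.KontsevichZagierPeriods.KontsevichZagierPeriods.Theorems.MzvKernelInKZ.Negative.PiLine
import Mathlib.NumberTheory.Niven

/-!
# Bottom cell of the Chebyshev ladder (crux `HurwitzSectorComplement`, line
# `chebyshev-level-deformation`, stub S2b `stub_bottomCell`)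

The bottom representation of the Chebyshev ladder in the half-angle coordinate `v = tan(u/2)`,
`𝔘_{1,k+1}(v₀) = [(0,1)_x × {0 < y_0 < ⋯ < y_k < v₀}, (∏ 2/(1+y_i²)) · U(y_0, x)]`,
`U(v,x) = 2v/((1−x)² + v²(1+x)²)`, `v₀ = tan(πj/L)` (`0 < j`, `2j < L`), is KZ-equivalent to a
RATIONAL multiple of the normal form `𝔭_{k+2} = [(0,1)^{k+2}, ∏ 2/(1+x_i²)]`, GIVEN the two
statements of stub S2a (chains over cyclotomic arcs, and the half-line `[(0,∞), dt/(1+t²)]`, are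
rational multiples of the normal forms). Moves used (Kontsevich–Zagier's rules (1), (2) only):

* `x` is moved to the last coordinate (a coordinate permutation,
  `KZ.of_sub_of_reindex_mem_relations`);
* the fibre substitution `t = y_0 (1+x)/(1−x)`, `U(y_0,x) dx = dt/(1+t²)`, `t ∈ (y_0, ∞)`
  (`of_sub_of_mem_relations_bottomCov` of the auxiliary file) lands on
  `R∞ = [{y ∈ G, t > y_0}, (∏ 2/(1+y_i²))/(1+t²)]`, `G` the chain `0 < y_0 < ⋯ < y_k < v₀`;
* domain additivity: `[G × (0,∞), (∏ 2/(1+y_i²)) ⊗ 1/(1+t²)] = [R∞] + [{y ∈ G, 0 < t < y_0}, …]`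
  (the wall `t = y_0` is a null graph), the left side being the Fubini PRODUCT
  `[G, ∏ 2/(1+y_i²)] × [(0,∞), dt/(1+t²)]` — a product of S2a(i) (`j₀ = 0`) and S2a(ii),
  hence `∼ q₁ 𝔭_{k+1} × 𝔭₁ = q₁ 𝔭_{k+2}`;
* the cell `{0 < t < y_0 < ⋯ < y_k < v₀}` with `1/(1+t²) = ½ · 2/(1+t²)` is, after rotating `t`
  to the front, one half of the chain of length `k + 2`, `∼ (q₂/2) 𝔭_{k+2}` by S2a(i) and the
  scaling `KZ.IntegralRep.constMul ½`;
* the box representations `[box, q ∏ 2/(1+x_i²)]` are additive in `q`, so `q = q₁ − q₂/2`.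

Value check: `∫ = (π/2) θ^{k+1}/(k+1)! − ½ θ^{k+2}/(k+2)!`, `θ = 2πj/L`.

References: M. Kontsevich, D. Zagier, *Periods* (2001), §1.2, rules (1)–(2) and §4.1 (Fubini).
-/

noncomputable section

open Set MeasureTheory
open scoped BigOperators
open Literature.NumberTheory.Transcendental
open Literature.ModelTheory.ExponentialFields (IsSemialgebraic)

namespace Summit.KontsevichZagierPeriods.Theorems.HurwitzMicroSectorsHurwitzSectorComplement

section Main

open Summit.KontsevichZagierPeriods.MzvKernelInKZ.Negative (hq lineRep sa_Ioi1)

/-- **S2b, bottom cell.** Given S2a: for `0 < j`, `2j < L`, `v₀ = tan(πj/L)`, the representation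
`[(0,1)_x × {0 < y_0 < ⋯ < y_k < v₀}, (∏ 2/(1+y_i²)) · U(y_0, x)]` is KZ-equivalent to a rational
multiple of `𝔭_{k+2}`: the `x`-fibre substitution `z = (x(1+y₀²) − (1−y₀²))/(2y₀)` is affine with
`U dx = dz/(1+z²)`, `z ∈ ((y₀²−1)/(2y₀), y₀)`; the region splits (cells `y_i ≶ 1`, `z ≶ 0`) into
products of chains over the arcs `(0, π/2)`, `(π/2, 2πj/L)` and half-lines, via the Möbius maps
`z ↦ −1/z`, `z ↦ 2z/(1−z²)`, `z ↦ (z²−1)/(2z)`, `v ↦ (v−1)/(v+1)`. Proof given here: composing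
the affine substitution with the rotation `z ↦ (y₀z+1)/(y₀−z)` gives the single substitution
`t = y₀(1+x)/(1−x) ∈ (y₀, ∞)` with `U(y₀,x)dx = dt/(1+t²)` (`of_sub_of_mem_relations_bottomCov`);
then `[{t > y₀}] = [chain] × [(0,∞), dt/(1+t²)] − [{0 < t < y₀ < ⋯}]`, the first a product of
S2a(i) (`j₀ = 0`) with S2a(ii), the second one half of S2a(i) in length `k + 2` after rotating
`t` to the front. [cite: KontsevichZagier2001, §1.2] -/
theorem stub_bottomCell :
    (∀ (a j₀ j₁ L : ℕ), j₀ < j₁ → 2 * j₁ < L → ∀ (r : KZ.IntegralRep a),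
      r.domain = {y | (∀ i, Real.tan (Real.pi * j₀ / L) < y i ∧ y i < Real.tan (Real.pi * j₁ / L)) ∧
        (∀ i i' : Fin a, i < i' → y i < y i')} →
      Set.EqOn r.integrand (fun y => ∏ i, 2 / (1 + (y i) ^ 2)) r.domain →
      ∃ q : ℚ, ∀ (s : KZ.IntegralRep a), s.domain = {x | ∀ i, x i ∈ Set.Ioo (0:ℝ) 1} →
        Set.EqOn s.integrand (fun x => (q : ℝ) * ∏ i, 2 / (1 + (x i) ^ 2)) s.domain →
        KZ.Equivalent r s) →
    (∀ (r : KZ.IntegralRep 1), r.domain = {z | 0 < z 0} →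
      Set.EqOn r.integrand (fun z => 1 / (1 + (z 0) ^ 2)) r.domain →
      ∀ (s : KZ.IntegralRep 1), s.domain = {x | ∀ i, x i ∈ Set.Ioo (0:ℝ) 1} →
        Set.EqOn s.integrand (fun x => ∏ i, 2 / (1 + (x i) ^ 2)) s.domain →
        KZ.Equivalent r s) →
    ∀ (k j L : ℕ), 0 < j → 2 * j < L → ∀ (r : KZ.IntegralRep (1 + (k + 1))),
      r.domain = {z | z (Fin.castAdd (k + 1) 0) ∈ Set.Ioo (0:ℝ) 1 ∧
        (∀ i : Fin (k + 1), 0 < z (Fin.natAdd 1 i) ∧ z (Fin.natAdd 1 i) < Real.tan (Real.pi * j / L)) ∧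
        (∀ i i' : Fin (k + 1), i < i' → z (Fin.natAdd 1 i) < z (Fin.natAdd 1 i'))} →
      Set.EqOn r.integrand (fun z => (∏ i : Fin (k + 1), 2 / (1 + (z (Fin.natAdd 1 i)) ^ 2)) *
        (2 * z (Fin.natAdd 1 0) /
          ((1 - z (Fin.castAdd (k + 1) 0)) ^ 2 +
            (z (Fin.natAdd 1 0)) ^ 2 * (1 + z (Fin.castAdd (k + 1) 0)) ^ 2))) r.domain →
      ∃ q : ℚ, ∀ (s : KZ.IntegralRep (1 + (k + 1))), s.domain = {x | ∀ i, x i ∈ Set.Ioo (0:ℝ) 1} →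
        Set.EqOn s.integrand (fun x => (q : ℝ) * ∏ i, 2 / (1 + (x i) ^ 2)) s.domain →
        KZ.Equivalent r s := by
  intro hArc hLine k j L hj hjL r hr_dom hr_int
  -- the cyclotomic half-angle `v₀ = tan(πj/L)`, an algebraic number
  have hv₀alg : IsAlgebraic ℚ (Real.tan (Real.pi * j / L)) := by
    have h := (Real.isAlgebraic_tan_rat_mul_pi ((j : ℚ) / L)).extendScalars
      (R := ℤ) (S := ℚ) (A := ℝ) (RingHom.injective_int (algebraMap ℤ ℚ))
    convert h using 2
    push_cast
    ring
  set v₀ : ℝ := Real.tan (Real.pi * j / L) with hv₀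
  have hhalf : IsAlgebraic ℚ ((2:ℝ)⁻¹) := by
    simpa using (isAlgebraic_nat (R := ℚ) (A := ℝ) 2).inv
  -- the chain base `G = {0 < y_0 < ⋯ < y_k < v₀}` carrying the weight `∏ 2/(1+y_i²)`
  obtain ⟨RG, hRGd, hRGi⟩ := exists_weightRep
    (isSemialgebraic_chain (k + 1) isAlgebraic_zero hv₀alg) (isBounded_chain (k + 1) 0 v₀) 1
  have hG0 : ∀ y ∈ RG.domain, 0 < y 0 := fun y hy => by
    rw [hRGd] at hy
    exact (hy.1 0).1
  -- the half-line `T = [(0,∞), dt/(1+t²)]`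
  have hS : IsSemialgebraic ℚ {x : Fin 1 → ℝ | 0 < x 0} := by simpa using sa_Ioi1 0
  set T : KZ.IntegralRep 1 := lineRep {x : Fin 1 → ℝ | 0 < x 0} hS with hT
  -- the product `P = [G, ∏ 2/(1+y_i²)] × T` (coordinates `(y, t)`, `t` last) and its integrand
  set P : KZ.IntegralRep (k + 1 + 1) := RG.prod T with hP
  have hPi : ∀ w : Fin (k + 1 + 1) → ℝ, P.integrand w =
      (∏ i : Fin (k + 1), 2 / (1 + (Fin.init w i) ^ 2)) *
        (1 / (1 + (w (Fin.last (k + 1))) ^ 2)) := by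
    intro w
    rw [hP, KZ.IntegralRep.prod_integrand_eq, KZ.IntegralRep.prodFun_apply, hRGi]
    simp only [Rat.cast_one, one_mul]
    rfl
  -- the two cells of `P`: `t > y 0` (the target of the substitution) and `0 < t < y 0`
  set Sinf : Set (Fin (k + 1 + 1) → ℝ) := {w | (Fin.init w : Fin (k + 1) → ℝ) ∈ RG.domain ∧
    Fin.init w 0 < w (Fin.last (k + 1))} with hSinf
  set Slow : Set (Fin (k + 1 + 1) → ℝ) := {w | (Fin.init w : Fin (k + 1) → ℝ) ∈ RG.domain ∧
    0 < w (Fin.last (k + 1)) ∧ w (Fin.last (k + 1)) < Fin.init w 0} with hSlow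
  have hsa_init : IsSemialgebraic ℚ
      {w : Fin (k + 1 + 1) → ℝ | (Fin.init w : Fin (k + 1) → ℝ) ∈ RG.domain} :=
    RG.isSemialgebraic_domain.setOf_init_mem
  have hsa1 : IsSemialgebraic ℚ {w : Fin (k + 1 + 1) → ℝ | w 0 < w (Fin.last (k + 1))} := by
    simpa using Literature.ModelTheory.ExponentialFields.isSemialgebraic_setOf_eval_lt (k := ℚ)
      (MvPolynomial.X (Fin.castSucc (0 : Fin (k + 1))) : MvPolynomial (Fin (k + 1 + 1)) ℚ)
      (MvPolynomial.X (Fin.last (k + 1)))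
  have hsa2 : IsSemialgebraic ℚ {w : Fin (k + 1 + 1) → ℝ | 0 < w (Fin.last (k + 1))} := by
    simpa using Literature.ModelTheory.ExponentialFields.isSemialgebraic_setOf_eval_pos (k := ℚ)
      (R := ℝ) (MvPolynomial.X (Fin.last (k + 1)) : MvPolynomial (Fin (k + 1 + 1)) ℚ)
  have hsa3 : IsSemialgebraic ℚ {w : Fin (k + 1 + 1) → ℝ | w (Fin.last (k + 1)) < w 0} := by
    simpa using Literature.ModelTheory.ExponentialFields.isSemialgebraic_setOf_eval_lt (k := ℚ)
      (MvPolynomial.X (Fin.last (k + 1)) : MvPolynomial (Fin (k + 1 + 1)) ℚ)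
      (MvPolynomial.X (Fin.castSucc (0 : Fin (k + 1))))
  have hSinf_sa : IsSemialgebraic ℚ Sinf := hsa_init.inter hsa1
  have hSlow_sa : IsSemialgebraic ℚ Slow := hsa_init.inter (hsa2.inter hsa3)
  have hSinf_sub : Sinf ⊆ P.domain := fun w hw => ⟨hw.1, (hG0 _ hw.1).trans hw.2⟩
  have hSlow_sub : Slow ⊆ P.domain := fun w hw => ⟨hw.1, hw.2.1⟩
  set Rinf : KZ.IntegralRep (k + 1 + 1) := P.restrict Sinf hSinf_sa hSinf_sub with hRinf
  set Rlow : KZ.IntegralRep (k + 1 + 1) := P.restrict Slow hSlow_sa hSlow_sub with hRlow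
  -- Step 1: move `x` to the last coordinate (a coordinate permutation, rule 2)
  set r' : KZ.IntegralRep (k + 1 + 1) := r.reindex finAddFlip with hr'
  have h1 : KZ.of r - KZ.of r' ∈ KZ.relations := KZ.of_sub_of_reindex_mem_relations r finAddFlip
  have hr'd : r'.domain = {w : Fin (k + 1 + 1) → ℝ |
      (Fin.init w : Fin (k + 1) → ℝ) ∈ RG.domain ∧ w (Fin.last (k + 1)) ∈ Ioo (0:ℝ) 1} := by
    ext w
    simp only [hr', KZ.IntegralRep.reindex_domain, mem_setOf_eq, hr_dom, hRGd,
      finAddFlip_apply_castAdd, finAddFlip_apply_natAdd]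
    exact ⟨fun h => ⟨h.2, h.1⟩, fun h => ⟨h.2, h.1⟩⟩
  -- Step 2: the fibre substitution `t = y₀ (1+x)/(1−x)` (rule 2)
  have h2 : KZ.of r' - KZ.of Rinf ∈ KZ.relations := by
    refine of_sub_of_mem_relations_bottomCov hG0 (fun y => ∏ i, 2 / (1 + (y i) ^ 2)) r' Rinf hr'd
      ?_ rfl (fun w _ => hPi w)
    intro w hw
    have hw' : (fun i => w (finAddFlip i)) ∈ r.domain := hw
    simp only [hr', KZ.IntegralRep.reindex_integrand]
    rw [hr_int hw']
    simp only [finAddFlip_apply_castAdd, finAddFlip_apply_natAdd]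
    rfl
  -- Step 3: `[P] ≡ [Rinf] + [Rlow]` (domain additivity; the wall `t = y₀` is null)
  have h3 : KZ.of P - KZ.of Rinf - KZ.of Rlow ∈ KZ.relations := by
    have hnull : volume (P.domain \ (Sinf ∪ Slow)) = 0 := by
      refine measure_mono_null (fun w hw => ?_)
        (KZ.volume_graph_eq_zero
          (isSemialgebraicFunOn_apply RG.isSemialgebraic_domain (0 : Fin (k + 1))))
      obtain ⟨⟨hG, ht⟩, hnot⟩ := hw
      have ht' : 0 < w (Fin.last (k + 1)) := ht
      refine ⟨hG, ?_⟩
      simp only [hSinf, hSlow, mem_union, mem_setOf_eq, not_or, not_and, not_lt] at hnot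
      exact le_antisymm (hnot.1 hG) (hnot.2 hG ht')
    have hU_sa : IsSemialgebraic ℚ (Sinf ∪ Slow) := hSinf_sa.union hSlow_sa
    have hU_sub : Sinf ∪ Slow ⊆ P.domain := union_subset hSinf_sub hSlow_sub
    have hA : KZ.of P - KZ.of (P.restrict _ hU_sa hU_sub) ∈ KZ.relations :=
      KZ.IntegralRep.of_sub_of_restrict_mem_relations P hU_sa hU_sub hnull
    have hB : KZ.of (P.restrict _ hU_sa hU_sub) - KZ.of Rinf - KZ.of Rlow ∈ KZ.relations := by
      refine KZ.domainAddRel_subset_relations ⟨k + 1 + 1, P.restrict _ hU_sa hU_sub, Rinf, Rlow,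
        rfl, ?_, fun _ _ => rfl, fun _ _ => rfl, rfl⟩
      have he : Rinf.domain ∩ Rlow.domain = ∅ := by
        ext w
        simp only [hRinf, hRlow, KZ.IntegralRep.domain_restrict, hSinf, hSlow, mem_inter_iff,
          mem_setOf_eq, mem_empty_iff_false, iff_false, not_and]
        intro h _ _ h'
        exact (lt_asymm h.2 h').elim
      rw [he, measure_empty]
    have : KZ.of P - KZ.of Rinf - KZ.of Rlow = (KZ.of P - KZ.of (P.restrict _ hU_sa hU_sub)) +
        (KZ.of (P.restrict _ hU_sa hU_sub) - KZ.of Rinf - KZ.of Rlow) := by abel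
    rw [this]
    exact KZ.relations.add_mem hA hB
  -- Step 4: the cell `0 < t < y 0 < ⋯ < y_k < v₀` is one half of the chain of length `k + 2`
  obtain ⟨rc, hrcd, hrci⟩ := exists_weightRep
    (isSemialgebraic_chain (k + 1 + 1) isAlgebraic_zero hv₀alg) (isBounded_chain (k + 1 + 1) 0 v₀) 1
  have h6 : KZ.of Rlow - KZ.of (Rlow.reindex (finRotate (k + 1 + 1))) ∈ KZ.relations :=
    KZ.of_sub_of_reindex_mem_relations _ _
  have h7 : KZ.of (Rlow.reindex (finRotate (k + 1 + 1))) - KZ.of (rc.constMul _ hhalf) ∈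
      KZ.relations := by
    refine KZ.of_sub_of_mem_relations_of_eqOn ?_ ?_
    · rw [KZ.IntegralRep.domain_constMul, hrcd]
      ext c
      simp only [KZ.IntegralRep.reindex_domain, hRlow, KZ.IntegralRep.domain_restrict, hSlow, hRGd,
        mem_setOf_eq, Fin.init, finRotate_apply, Fin.coeSucc_eq_succ, Fin.last_add_one,
        Fin.castSucc_zero, zero_add]
      exact (rotate_chain_iff k v₀ c).symm
    · intro c _
      simp only [KZ.IntegralRep.reindex_integrand, hRlow, KZ.IntegralRep.integrand_restrict,
        KZ.IntegralRep.integrand_constMul, hrci, hPi]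
      simp only [Fin.init, finRotate_apply, Fin.coeSucc_eq_succ, Fin.last_add_one, Rat.cast_one,
        one_mul]
      rw [Fin.prod_univ_succ (f := fun i : Fin (k + 1 + 1) => 2 / (1 + (c i) ^ 2))]
      ring
  -- Step 5: the normal forms, from S2a
  obtain ⟨q₁, hq₁⟩ := hArc (k + 1) 0 j L hj hjL RG (by rw [hRGd]; simp [hv₀])
    (fun y _ => by simp [hRGi])
  have hTline := hLine T rfl (fun x _ => rfl)
  obtain ⟨q₂, hq₂⟩ := hArc (k + 1 + 1) 0 j L hj hjL rc (by rw [hrcd]; simp [hv₀])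
    (fun y _ => by simp [hrci])
  obtain ⟨S₁, hS₁d, hS₁i⟩ := exists_weightRep (D := {x : Fin (k + 1) → ℝ | ∀ i, x i ∈ Ioo (0:ℝ) 1})
    isSemialgebraic_openUnitCube (isBounded_unitBox _) q₁
  obtain ⟨S₂, hS₂d, hS₂i⟩ := exists_weightRep (D := {x : Fin 1 → ℝ | ∀ i, x i ∈ Ioo (0:ℝ) 1})
    isSemialgebraic_openUnitCube (isBounded_unitBox _) 1
  obtain ⟨S₃, hS₃d, hS₃i⟩ :=
    exists_weightRep (D := {x : Fin (k + 1 + 1) → ℝ | ∀ i, x i ∈ Ioo (0:ℝ) 1})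
      isSemialgebraic_openUnitCube (isBounded_unitBox _) q₂
  obtain ⟨B₁, hB₁d, hB₁i⟩ :=
    exists_weightRep (D := {x : Fin (k + 1 + 1) → ℝ | ∀ i, x i ∈ Ioo (0:ℝ) 1})
      isSemialgebraic_openUnitCube (isBounded_unitBox _) q₁
  obtain ⟨B, hBd, hBi⟩ :=
    exists_weightRep (D := {x : Fin (k + 1 + 1) → ℝ | ∀ i, x i ∈ Ioo (0:ℝ) 1})
      isSemialgebraic_openUnitCube (isBounded_unitBox _) (q₁ - q₂ / 2)
  have e1 : KZ.Equivalent RG S₁ := hq₁ S₁ hS₁d (fun x _ => by rw [hS₁i])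
  have e2 : KZ.Equivalent T S₂ := hTline S₂ hS₂d (fun x _ => by simp [hS₂i])
  have e3 : KZ.Equivalent rc S₃ := hq₂ S₃ hS₃d (fun x _ => by rw [hS₃i])
  have h4 : KZ.of P - KZ.of (S₁.prod S₂) ∈ KZ.relations := KZ.Equivalent.prod e1 e2
  have h5 : KZ.of (S₁.prod S₂) - KZ.of B₁ ∈ KZ.relations := by
    refine KZ.of_sub_of_mem_relations_of_eqOn ?_ ?_
    · rw [hB₁d, KZ.IntegralRep.prod_domain]
      ext z
      simp only [KZ.IntegralRep.mem_prodDomain, hS₁d, hS₂d, mem_setOf_eq]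
      exact ⟨fun h => ⟨fun i => h _, fun i => h _⟩, fun h i =>
        Fin.addCases (motive := fun i => z i ∈ Ioo (0:ℝ) 1) (fun i => h.1 i) (fun i => h.2 i) i⟩
    · intro z _
      rw [KZ.IntegralRep.prod_integrand_eq, KZ.IntegralRep.prodFun_apply, hS₁i, hS₂i, hB₁i]
      simp only [Rat.cast_one, one_mul]
      rw [Fin.prod_univ_add (f := fun i : Fin (k + 1 + 1) => 2 / (1 + (z i) ^ 2))]
      ring
  have h8 : KZ.of (rc.constMul _ hhalf) - KZ.of (S₃.constMul _ hhalf) ∈ KZ.relations :=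
    KZ.Equivalent.constMul _ hhalf e3
  have h9 : KZ.of B₁ - KZ.of B - KZ.of (S₃.constMul _ hhalf) ∈ KZ.relations := by
    refine KZ.integrandAddRel_subset_relations
      ⟨k + 1 + 1, B₁, B, S₃.constMul _ hhalf, ?_, ?_, ?_, rfl⟩
    · rw [hBd, hB₁d]
    · rw [KZ.IntegralRep.domain_constMul, hS₃d, hB₁d]
    · intro x _
      simp only [Pi.add_apply, KZ.IntegralRep.integrand_constMul, hB₁i, hBi, hS₃i]
      push_cast
      ring
  -- the answer `q = q₁ − q₂/2`
  refine ⟨q₁ - q₂ / 2, fun s hs_dom hs_int => ?_⟩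
  have h10 : KZ.of s - KZ.of (s.reindex finAddFlip) ∈ KZ.relations :=
    KZ.of_sub_of_reindex_mem_relations s finAddFlip
  have h11 : KZ.of (s.reindex (finAddFlip : Fin (1 + (k + 1)) ≃ Fin (k + 1 + 1))) - KZ.of B ∈
      KZ.relations := by
    refine KZ.of_sub_of_mem_relations_of_eqOn ?_ ?_
    · rw [hBd]
      ext w
      simp only [KZ.IntegralRep.reindex_domain, mem_setOf_eq, hs_dom]
      exact ⟨fun h i => h (finAddFlip i), fun h i => by simpa using h (finAddFlip.symm i)⟩
    · intro w hw
      have hw' : (fun i => w (finAddFlip i)) ∈ s.domain := hw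
      simp only [KZ.IntegralRep.reindex_integrand, hBi]
      rw [hs_int hw']
      push_cast
      congr 1
      exact Equiv.prod_comp finAddFlip (fun i => 2 / (1 + (w i) ^ 2))
  -- assembly in the formal period ring
  have t1 := KZ.toFormalPeriod_eq_zero_of_mem h1
  have t2 := KZ.toFormalPeriod_eq_zero_of_mem h2
  have t3 := KZ.toFormalPeriod_eq_zero_of_mem h3
  have t4 := KZ.toFormalPeriod_eq_zero_of_mem h4
  have t5 := KZ.toFormalPeriod_eq_zero_of_mem h5
  have t6 := KZ.toFormalPeriod_eq_zero_of_mem h6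
  have t7 := KZ.toFormalPeriod_eq_zero_of_mem h7
  have t8 := KZ.toFormalPeriod_eq_zero_of_mem h8
  have t9 := KZ.toFormalPeriod_eq_zero_of_mem h9
  have t10 := KZ.toFormalPeriod_eq_zero_of_mem h10
  have t11 := KZ.toFormalPeriod_eq_zero_of_mem h11
  rw [KZ.Equivalent, ← KZ.toFormalPeriod_eq_zero_iff]
  simp only [map_sub] at t1 t2 t3 t4 t5 t6 t7 t8 t9 t10 t11 ⊢
  linear_combination t1 + t2 - t3 + t4 + t5 + t9 - t6 - t7 - t8 - t11 - t10

end Main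

end Summit.KontsevichZagierPeriods.Theorems.HurwitzMicroSectorsHurwitzSectorComplement

end
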